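import Literature.AlgebraicGeometry.Resolution.RegularHomRegularLocus
import Literature.AlgebraicGeometry.Resolution.RegularHomReduced
import Literature.AlgebraicGeometry.Resolution.CompletionBaseChange
import Literature.AlgebraicGeometry.Resolution.FlatLocalRegularAscent
import Mathlib.RingTheory.AdicCompletion.LocalRing
import Mathlib.RingTheory.TensorProduct.Basic
import HarnessLib

/-!
# The `g`-adic completion of a quasi-excellent `ℚ`-domain: the ring-theoretic inputs of Temkin's local step

Topic: `Literature/AlgebraicGeometry/Resolution`. Ring lemmas for the reduction of the named fact
`Hironaka1964_local` (Hironaka 1964, Main Theorem I, over local quasi-excellent rings of residue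
characteristic zero, as read by Temkin 2008) along Temkin's Hironaka-free proof. After
`Hironaka1964LocalAffineChart.lean` the fact is reduced to the principal affine case (A): blow-ups
of `Spec A` centred in `V(g)`, for a quasi-excellent `ℚ`-domain `A` with `A[1/g]` regular and
`A/gA` of finite type over a field, admit desingularizations. Temkin's local step (proof of
Thm. 3.4.1, p. 18; Lemma 3.1.4, p. 15: "Obviously, `𝔛 = Spf(Â)`, where `Â` is the `P`-adic
completion of `A`. Since `A` is quasi-excellent, the homomorphism `A → Â` is regular by [EGA IV]")
passes to the `g`-adic completion `Â`. This file collects, sorry-free, what the passage needs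
about the ring `Â = AdicCompletion (g) A` (Mathlib) and about base changes `B ⊗_A Â`:

* `exists_sub_tmul_one_mem_map_pow` — **every element of `B ⊗_A Â` is `≡ b ⊗ 1 (mod Iⁿ)`**
  (from `A/Iⁿ ≅ Â/IⁿÂ`, `CompletionBaseChange.lean`: `quotientMap_pow_bijective_adicCompletion`,
  `exists_sub_algebraMap_mem_map_pow`; the version there, `exists_sub_tensorInr_mem`, has the
  completed base on the left, `Â ⊗_A C`, whereas affine pieces of `Y ×_{Spec A} Spec Â` come as
  `B ⊗_A Â`, Mathlib's `pullbackSpecIso`);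
* `Ideal.map_comap_eq_of_forall_sub_mem` — if every element of `C` is `≡ θ(b)` modulo an
  extended ideal `𝔟₀C ⊆ J`, then `J = (θ⁻¹J)·C`: ideals of `C` containing `𝔟₀C` are extended
  from `B` (the descent of blow-up centres supported in `V(g)` from `Y ×_A Â` to `Y`);
* `isRegularLocalRing_localization_of_forall_sub_mem` — **regularity ascends at the primes
  above `𝔟₀T`** along a flat `B → T` with `T ≡ B (mod 𝔟₀T)` (Matsumura 23.7 (ii) with trivial
  closed fibre, `FlatLocalRegularAscent.lean`): the points of `Y ×_A Spec Â` over `V(g)` are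
  regular when their images in `Y` are;
* `isAdicComplete_span_algebraMap` — `Â` is `ĝ`-adically complete;
* `isUnit_natCast_adicCompletion` — `Â ⊇ ℚ` when `A ⊇ ℚ`;
* `mem_regularLocus_adicCompletion_of_regularHom` — **along the regular homomorphism `A → Â`
  (the hypothesis (REG), EGA IV₂ 7.8.3 (v)) `Â` is regular at every prime `𝔔` with `A`
  regular at `𝔔 ∩ A`** (`IsRegularHom.isRegularLocalRing_localization_iff`, Matsumura 23.7);
  in particular `Â[1/g]` is regular when `A[1/g]` is (`rigRegular_adicCompletion`: Temkin's
  "rig-regularity" of `Spf Â`, Cor. 3.1.5 (ii)); and `Â` is reduced (`IsRegularHom.isReduced`).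

No named fact is introduced; (REG) appears only as a hypothesis.

## Sources

* M. Temkin, *Desingularization of quasi-excellent schemes in characteristic zero*, Adv. Math.
  219 (2008) 488–522 = arXiv:math/0703678 (arXiv pagination): Lemma 3.1.4, Cor. 3.1.5 (p. 15),
  proof of Thm. 3.4.1 (p. 18). [Temkin2008]
* H. Matsumura, *Commutative Ring Theory*, CUP 1986, Thm. 8.11, Thm. 23.7, §32. [Matsumura1987]
-/

noncomputable section

open IsLocalRing TensorProduct

namespace Literature.AlgebraicGeometry.Resolution

universe u v

/-! ## `B ⊗_A Â → B/IⁿB` is onto -/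

section Quotients

variable {R : Type u} [CommRing R] (I : Ideal R)

/-- **Every element of `B ⊗_R Â` is congruent modulo `Iⁿ(B ⊗_R Â)` to some `b ⊗ 1`** (base
change of `R/Iⁿ ≅ Â/IⁿÂ`: `B ⊗_R Â → B/IⁿB` is onto). [folklore] -/
theorem exists_sub_tmul_one_mem_map_pow (fg : I.FG) (n : ℕ) (B : Type v) [CommRing B]
    [Algebra R B] (w : B ⊗[R] AdicCompletion I R) :
    ∃ b : B, w - b ⊗ₜ 1 ∈ (I ^ n).map (algebraMap R (B ⊗[R] AdicCompletion I R)) := by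
  set K : Ideal (B ⊗[R] AdicCompletion I R) := (I ^ n).map (algebraMap R _) with hK
  induction w using TensorProduct.induction_on with
  | zero => exact ⟨0, by simp⟩
  | tmul b x =>
    obtain ⟨a, ha⟩ := exists_sub_algebraMap_mem_map_pow I
      (quotientMap_pow_bijective_adicCompletion I fg) n x
    refine ⟨a • b, ?_⟩
    have h1 : (a • b) ⊗ₜ[R] (1 : AdicCompletion I R) =
        b ⊗ₜ[R] algebraMap R (AdicCompletion I R) a := by
      rw [smul_tmul, Algebra.smul_def, mul_one]
    have h2 : b ⊗ₜ[R] x - b ⊗ₜ[R] algebraMap R (AdicCompletion I R) a =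
        (b ⊗ₜ[R] (1 : AdicCompletion I R)) *
          Algebra.TensorProduct.includeRight (R := R) (A := B)
            (x - algebraMap R (AdicCompletion I R) a) := by
      rw [Algebra.TensorProduct.includeRight_apply, Algebra.TensorProduct.tmul_mul_tmul, one_mul,
        mul_one, tmul_sub]
    rw [h1, h2]
    refine Ideal.mul_mem_left _ _ ?_
    have h3 : ((I ^ n).map (algebraMap R (AdicCompletion I R))).map
        (Algebra.TensorProduct.includeRight (R := R) (A := B) (B := AdicCompletion I R)).toRingHom
          ≤ K := by
      rw [hK, Ideal.map_map, AlgHom.toRingHom_eq_coe, AlgHom.comp_algebraMap]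
    exact h3 (Ideal.mem_map_of_mem _ ha)
  | add w₁ w₂ h₁ h₂ =>
    obtain ⟨b₁, hb₁⟩ := h₁
    obtain ⟨b₂, hb₂⟩ := h₂
    refine ⟨b₁ + b₂, ?_⟩
    have : w₁ + w₂ - (b₁ + b₂) ⊗ₜ[R] (1 : AdicCompletion I R) =
        (w₁ - b₁ ⊗ₜ 1) + (w₂ - b₂ ⊗ₜ 1) := by
      rw [add_tmul]; abel
    rw [this]
    exact K.add_mem hb₁ hb₂

end Quotients

/-! ## Ideals containing `𝔟₀C` are extended, when everything is `≡ θ(b) (mod 𝔟₀C)` -/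

/-- **Ideals above `𝔟₀C` are extended from `B`**: if `θ : B → C` and every `c ∈ C` is congruent
modulo the extended ideal `𝔟₀C` to some `θ(b)`, then every ideal `J ⊇ 𝔟₀C` of `C` satisfies
`J = (θ⁻¹J) C`. (For `C = B ⊗_A Â`, `𝔟₀ = gⁿB`: blow-up centres supported in `V(g)` on
`Y ×_A Spec Â` descend to `Y`.) [folklore] -/
theorem Ideal.map_comap_eq_of_forall_sub_mem {B C : Type*} [CommRing B] [CommRing C]
    (θ : B →+* C) (𝔟₀ : Ideal B) (hsurj : ∀ c : C, ∃ b : B, c - θ b ∈ 𝔟₀.map θ) {J : Ideal C}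
    (hJ : 𝔟₀.map θ ≤ J) : (J.comap θ).map θ = J := by
  refine le_antisymm Ideal.map_comap_le fun x hx => ?_
  obtain ⟨b, hb⟩ := hsurj x
  have hθb : θ b ∈ J := by
    have : θ b = x - (x - θ b) := by ring
    rw [this]
    exact J.sub_mem hx (hJ hb)
  have h𝔟 : 𝔟₀.map θ ≤ (J.comap θ).map θ :=
    Ideal.map_mono (Ideal.map_le_iff_le_comap.mp hJ)
  have : x = (x - θ b) + θ b := by ring
  rw [this]
  exact Ideal.add_mem _ (h𝔟 hb) (Ideal.mem_map_of_mem θ (show b ∈ J.comap θ from hθb))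

/-! ## Regularity ascends along `B → T` at primes above `𝔟₀T`, when `T ≡ B (mod 𝔟₀T)` -/

/-- **Regularity ascends at the primes over `V(𝔟₀)`**: let `T` be a flat Noetherian `B`-algebra in
which every element is `≡ b (mod 𝔟₀T)` for some `b ∈ B` (so `B/𝔟₀ → T/𝔟₀T` is onto; e.g.
`T = B ⊗_A Â`, `𝔟₀ = gⁿB`, `exists_sub_tmul_one_mem_map_pow`). For a prime `𝔷 ⊇ 𝔟₀T` of `T`
with `𝔶 = 𝔷 ∩ B`, if `B_𝔶` is regular then `T_𝔷` is regular: `𝔷 = 𝔶T`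
(`Ideal.map_comap_eq_of_forall_sub_mem`), so `B_𝔶 → T_𝔷` is flat local with `𝔶 T_𝔷` the
maximal ideal, and Matsumura Thm. 23.7 (ii) applies
(`IsRegularLocalRing.of_flat_of_map_maximalIdeal_eq`). (The points of `Y ×_A Spec Â` over
`V(g)` are regular as soon as their images in `Y` are.) [cite: Matsumura1987, Thm. 23.7] -/
theorem isRegularLocalRing_localization_of_forall_sub_mem {B T : Type u} [CommRing B]
    [CommRing T] [Algebra B T] [Module.Flat B T] [IsNoetherianRing T] (𝔟₀ : Ideal B)
    (hsurj : ∀ c : T, ∃ b : B, c - algebraMap B T b ∈ 𝔟₀.map (algebraMap B T))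
    (𝔷 : Ideal T) [𝔷.IsPrime] (h𝔷 : 𝔟₀.map (algebraMap B T) ≤ 𝔷)
    (hreg : IsRegularLocalRing (Localization.AtPrime (𝔷.comap (algebraMap B T)))) :
    IsRegularLocalRing (Localization.AtPrime 𝔷) := by
  set 𝔶 := 𝔷.comap (algebraMap B T) with h𝔶
  set f := Localization.localRingHom 𝔶 𝔷 (algebraMap B T) h𝔶 with hfdef
  have hflatBT : (algebraMap B T).Flat := RingHom.flat_algebraMap_iff.mpr inferInstance
  have hf : f.Flat := hflatBT.localRingHom 𝔷 𝔶 h𝔶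
  letI : Algebra (Localization.AtPrime 𝔶) (Localization.AtPrime 𝔷) := f.toAlgebra
  haveI : Module.Flat (Localization.AtPrime 𝔶) (Localization.AtPrime 𝔷) := hf
  haveI : IsLocalHom (algebraMap (Localization.AtPrime 𝔶) (Localization.AtPrime 𝔷)) :=
    Localization.isLocalHom_localRingHom 𝔶 𝔷 (algebraMap B T) h𝔶
  haveI := hreg
  refine IsRegularLocalRing.of_flat_of_map_maximalIdeal_eq (Localization.AtPrime 𝔶)
    (Localization.AtPrime 𝔷) ?_
  change (maximalIdeal (Localization.AtPrime 𝔶)).map f = maximalIdeal (Localization.AtPrime 𝔷)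
  rw [← Localization.AtPrime.map_eq_maximalIdeal, ← Localization.AtPrime.map_eq_maximalIdeal,
    Ideal.map_map]
  have hcomp : f.comp (algebraMap B (Localization.AtPrime 𝔶)) =
      (algebraMap T (Localization.AtPrime 𝔷)).comp (algebraMap B T) := by
    ext b
    exact Localization.localRingHom_to_map 𝔶 𝔷 (algebraMap B T) h𝔶 b
  rw [hcomp, ← Ideal.map_map, Ideal.map_comap_eq_of_forall_sub_mem (algebraMap B T) 𝔟₀ hsurj h𝔷]

/-! ## The `g`-adic completion: completeness, `ℚ`, regularity along (REG) -/

section Completion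

variable {A : Type u} [CommRing A] (g : A)

/-- `IⁿÂ` for `I = (g)`: the extension of `(gⁿ)` to `Â` is generated by `ĝⁿ`. [folklore] -/
theorem map_span_singleton_pow_adicCompletion (n : ℕ) :
    (Ideal.span {g} ^ n).map (algebraMap A (AdicCompletion (Ideal.span {g}) A)) =
      Ideal.span {algebraMap A (AdicCompletion (Ideal.span {g}) A) g ^ n} := by
  rw [Ideal.span_singleton_pow, Ideal.map_span, Set.image_singleton, map_pow]

/-- **`Â` is `ĝ`-adically complete** (Mathlib's `AdicCompletion.isAdicComplete_self` for the
finitely generated ideal `(g)`). [cite: Matsumura1987, Thm. 8.11] -/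
theorem isAdicComplete_span_algebraMap :
    IsAdicComplete (Ideal.span {algebraMap A (AdicCompletion (Ideal.span {g}) A) g})
      (AdicCompletion (Ideal.span {g}) A) := by
  have h := AdicCompletion.isAdicComplete_self (Ideal.span {g}) (R := A) ⟨{g}, by simp⟩
  rwa [Ideal.map_span, Set.image_singleton] at h

/-- `Â ⊇ ℚ` when `A ⊇ ℚ`: nonzero integers stay units. [folklore] -/
theorem isUnit_natCast_adicCompletion (h : ∀ n : ℕ, n ≠ 0 → IsUnit (n : A)) (n : ℕ)
    (hn : n ≠ 0) : IsUnit (n : AdicCompletion (Ideal.span {g}) A) := by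
  simpa using (h n hn).map (algebraMap A (AdicCompletion (Ideal.span {g}) A))

/-- **Along the regular homomorphism `A → Â` (hypothesis (REG), EGA IV₂ 7.8.3 (v)), `Â` is
regular at every prime `𝔔` such that `A` is regular at `𝔔 ∩ A`** (Matsumura 23.7 (ii),
`IsRegularHom.isRegularLocalRing_localization_iff`). [cite: Matsumura1987, Thm. 23.7]
[cite: Temkin2008, Lemma 3.1.4 (proof, p. 15)] -/
theorem mem_regularLocus_adicCompletion_of_regularHom [IsNoetherianRing A] {I : Ideal A}
    (hREG : IsRegularHom A (AdicCompletion I A)) (Q : PrimeSpectrum (AdicCompletion I A))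
    (hQ : (⟨Q.asIdeal.under A, inferInstance⟩ : PrimeSpectrum A) ∈ regularLocus A) :
    Q ∈ regularLocus (AdicCompletion I A) := by
  haveI : IsNoetherianRing (AdicCompletion I A) := Stacks0316 A I
  rw [mem_regularLocus] at hQ ⊢
  exact (hREG.isRegularLocalRing_localization_iff Q.asIdeal).mpr hQ

/-- **Rig-regularity of `Spf Â`** (Temkin 2008, Cor. 3.1.5 (ii): "`𝔛` is rig-regular if and only
if there exists a neighborhood `U` of `Y` such that `U ∖ Y` is regular", here in the direction
used, over the whole `Spec A`): if `A_𝔭` is regular for every prime `𝔭 ∌ g` and `A → Â` is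
regular (REG), then `Â_𝔔` is regular for every prime `𝔔 ∌ ĝ` of the `g`-adic completion.
[cite: Temkin2008, Cor. 3.1.5 (ii) and Lemma 3.1.4] -/
theorem rigRegular_adicCompletion [IsNoetherianRing A]
    (hREG : IsRegularHom A (AdicCompletion (Ideal.span {g}) A))
    (hreg : ∀ P : PrimeSpectrum A, g ∉ P.asIdeal → P ∈ regularLocus A)
    (Q : PrimeSpectrum (AdicCompletion (Ideal.span {g}) A))
    (hQ : algebraMap A (AdicCompletion (Ideal.span {g}) A) g ∉ Q.asIdeal) :
    Q ∈ regularLocus (AdicCompletion (Ideal.span {g}) A) :=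
  mem_regularLocus_adicCompletion_of_regularHom hREG Q (hreg _ fun h => hQ (Ideal.mem_comap.mp h))

/-- `Â` is reduced when `A` is a Noetherian reduced ring and `A → Â` is regular (REG)
(Stacks 07QK, `IsRegularHom.isReduced`). [cite: Temkin2008, Cor. 3.1.5 (proof)] -/
theorem isReduced_adicCompletion_of_regularHom [IsNoetherianRing A] [IsReduced A] {I : Ideal A}
    (hREG : IsRegularHom A (AdicCompletion I A)) : IsReduced (AdicCompletion I A) :=
  hREG.isReduced

end Completion

end Literature.AlgebraicGeometry.Resolution

end
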